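import Literature.MathematicalPhysics.QuantumFieldTheory.Balaban1983to89.T4EtaRateOperatorTorus
import Literature.MathematicalPhysics.QuantumFieldTheory.Balaban1983to89.T4EtaRateSiteTorus163
import Literature.MathematicalPhysics.QuantumFieldTheory.Balaban1983to89.T4Hk163StripRate
import Literature.MathematicalPhysics.QuantumFieldTheory.Balaban1983to89.T4EtaRateUnitWitness

/-!
# `Balaban1983to89.NE2NodeTorus` — YM-DAG node N15 (NE2) KNIT BY NAME: the node shape `NE2PlusOperator ∧ NE2PlusSite 4 p ∧ NE2PlusUnit`
on ONE family of paired instances, inhabited hypothesis-free by the LANDAU-GAUGE VECTOR linear theory of [B5]/[B6] at `U ≡ 1` —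
`Δ_k` (1.66) [operator layer, King exponent γ = 2], `H_k` (1.63) [site layer, γ = 1, its strip-rate hypothesis now DISCHARGED],
`C^{(k)} = C(C*Δ_kC)⁻¹C*` (2.156) [unit layer, θ = L⁻¹] — uniformly in the volume

HONEST FRAMING.  Cell `pub-ymgap`, Track A (D-0062), seat `pub-ymgap-dag-n15-a` (KNIT-BY-NAME, node N15 = spine estimate NE2
«η-rate of the background-dependent linear theory»; statement of record = the three NE2⁺ layers of `T4EtaRate` —
`NE2PlusOperator` :250, `NE2PlusSite` :257, `NE2PlusUnit` :265 — as ONE conjunction on ONE `pi : I → PairedInstance` (venue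
`HOME/lean/ym-dag/N15_NE2.lean`, `YMDAG.N15 c35 p pi Kop Ksite Kunit inΛ unitDist`; = the K4 typing `N15At`).  Finite tori of the
[Balaban1983to89] programme; NOT continuum, NOT infinite volume, NOT OS / mass gap / Clay; count-neutral bookkeeping over the η-rate
lineage of cell `pub-balaban` (`T4EtaRate`, `T4EtaRateSiteTorus(163)`, `T4EtaRateOperatorTorus`, `T4EtaRateUnitWitness`,
`T4Cov2156Rate`, `T4Hk163StripRate`, `T4Rate166StripDirect`), imported BY NAME, nothing modified.

WHY A KNIT.  The three NE2 layers were inhabited on THREE DIFFERENT carrier families (`torusOpInstance`: sites `Tor N`, arguments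
realised; `torusInstance`: same sites, inert arguments; `covInstance`: torus BONDS one dimension down); N15 quantifies all three
over ONE `pi`.  Family of record here: `knitInstance d L : KnitIndex d L → PairedInstance` = the OPERATOR carriers restricted to
unit tori whose periods are multiples of the block factor `L` (the block structure (2.156) needs; index `(k, N, M)`, `L ∣ N_μ`,
all `M ≥ 1`, runs `k`/`k+1`, identity pairing).  On it: (a) any torus family `X` as an OPERATOR family (four (3.42) entries of the
η-difference convolution operator); (b) any torus family `Y` as a SITE kernel ON THE OPERATOR CARRIER (`opSiteKernel`; §1:
`EtaRateIneqSite` there IS `EtaRateIneqSite` on the site carrier, definitionally); (c) the η-difference of `C^{(k)}` read at the base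
points of two bonds of fixed directions (`covOpKernel`), `inΛ := True`, `unitDist := ρ_N` (periodic unit-lattice distance).

CONTENTS (0 sorry): §1 site kernels on the operator carrier + transfer of the packaged site layer; §2 re-indexing; §3 the knit
family, the covariance unit layer (**`etaRateIneqUnit_cov_knit`**, **`ne2PlusUnit_cov_knit`**); §4 **the (1.63) site layer
HYPOTHESIS-FREE** (`stripRate_hk163Zero` = `T4Hk163StripRate.stripRegular_G163_sub` at `zeroOffset_phys`; `ne2PlusSite_hk163Zero` —
the companion discharge announced in `T4EtaRateSiteTorus163` §4, not in the tree before); §5 **THE KNIT** `n15_knit_of_bounds`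
(two King-shape torus step bounds ⇒ the N15 conjunction; the slot for further rate theorems / a background-layer estimate in this
format) and **`n15_knit_LG`** (BY NAME, hypothesis-free), `n15_knit_LG_dim4`, trivial-background layers `n15zero_knit_LG`
(venue `N15zero`), `ne2ZeroSite_knit_LG`.

HONEST SCOPE / VACUITY LEDGER (for the referee's A1–A6).  (i) `U ≡ 1` ONLY: backgrounds = the lineage's one-point carrier `pt9Bg`,
on which (3.35)/(3.36) are `True`; in every `NE2Plus…` conclusion the background quantifier ranges over `{U ≡ 1}` — NE2⁰ CONTENT
inside NE2⁺'s TYPE (the lineage's HONEST SCOPE (ii) since `T4EtaRateUnitWitness`).  The background-dependent estimate NE2⁺ ([B9]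
Thms 3.1/3.15 print UNIFORMITY in η, never a difference; GAPS G-t4-U1a-4′) is NOT PRINTED, NOT PROVED, NOT CLAIMED — seat n15-b's
lane.  (ii) MODEL: single top scale, the fine lattice inside each unit block collapsed to its label (`T4EtaRateOperatorTorus` §1);
the multi-scale 𝔅 of [B9] with its realisation map is NODE 00's object, not constructed here; hence NOT a node discharge.  (iii) NOT
vacuous: index inhabited for every `k` (`KnitIndex.cube`); guards `M₅ ≤ M`, `0 < α₀`, `Mα₀ ≤ a₀` satisfiable at every index
(`M₅ = a₀ = 1`, `M` ranges over all reals `≥ 1`); background type inhabited; `inΛ := True`; rates `L⁻²`/`L⁻¹`/`L⁻¹` per scale,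
decay constants and uniformity in `(k, N, M)` genuine, from the cited kernel theorems.  (iv) Objects = the Landau-gauge VECTOR
linear theory of [B5]/[B6] at `U ≡ 1` with King-shape torus rate theorems in the tree; the propagator `G = Δ_a⁻¹` (1.83) itself
(`B5G183Rate*`, order two with King weights) is not used.  (v) No Prop-valued published fact introduced; nothing printed is a
hypothesis.  Locators (inherited from the imported cross-read headers; no page re-read for this bookkeeping): [B5] =
[Balaban1984PropagatorsI] CMP 95 (1984): (1.63) p. 28, (1.66) p. 29; [B6] = [Balaban1984PropagatorsII] CMP 96 (1984): (2.156)
p. 250; [B9] = [Balaban1985BackgroundPropagators] CMP 99 (1985): (3.42) p. 397, Thm 3.2 (3.48) p. 398, Thm 3.14 pp. 426–427, Thm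
3.15 (3.187) p. 432; [King1986] CMP 102 (1986): p. 664, Prop. 3.9 (3.73) p. 665, Lemma 4.5 (4.38) p. 674 (the printed A = 0
scalar template).
-/

namespace Literature.MathematicalPhysics.QuantumFieldTheory.Balaban1983to89.NE2NodeTorus

open T4EtaRate (EtaRateIneqSite EtaRateIneqUnit NE2PlusSite NE2PlusOperator NE2PlusUnit NE2ZeroOperator ne2Zero_of_ne2Plus
  PairedInstance)
open T4EtaRateDefectSite (pt9Bg)
open T4EtaRateSiteOfRatePair (NE2ZeroSite)
open T4EtaRateSiteTorus (torusStepKernel TorusIndex torusInstance TorusFamily torusStepKernels etaRateIneqSite_torus_iff'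
  ne2PlusSite_torus_of_bound_rpow ksum166Family)
open T4EtaRateSiteTorus163 (hk163ZeroFamily zeroOffset zeroOffset_phys ne2PlusSite_hk163Zero_of_stripRate
  ne2ZeroSite_hk163Zero_of_stripRate)
open T4EtaRateOperatorTorus (torusOpGeo torusOpInstance torusOpKernelFamilies ne2PlusOperator_torus_of_bound_rpow
  ne2PlusOperator_ksum166_king ne2ZeroOperator_ksum166_king)
open T4EtaRateUnitWitness (covDiff NE2ZeroUnit ne2ZeroUnit_of_ne2PlusUnit)
open T4Hk163StripRate (stripRegular_G163_sub CGe)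
open T4Cov2156Rate (cov2156_rate_torus_king)
open B5Prop11Plancherel (Tor)
open B6LowerBound2153Torus (toT rep rep_mem_pbox)
open B6Lemma24Torus (pbox)
open B6BondEliminationTorus (pdist)
open B6Cov2156Torus (one_le_M)
open B4TorusKernel.MultiPeriod (torusSupNorm)
open B4ContourShift (StripRegular)
open B5Hk163Strip (kappa163 kappa163_pos)
open B5Hk163Decay (G163)

noncomputable section

variable {d : ℕ}

/-! ## §1 Site kernels ON THE OPERATOR CARRIER: the site layer read on `torusOpGeo` is the site layer read on `torusSiteGeo` -/

section OpSite

variable {N : Fin (d + 1) → ℕ} [∀ μ, NeZero (N μ)]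

/-- THE η-DIFFERENCE SITE KERNEL ON THE OPERATOR CARRIER `torusOpGeo d L M k N` (same sites, metric and scale data as the site
carrier; arguments realised): `(U, y, y′) ↦ Xf(y − y′) − Xc(y − y′)` — the function of `T4EtaRateSiteTorus.torusStepKernel`, typed
over the operator carrier so that ONE paired instance carries both layers. [cite: King1986, p.664 (identity pairing) and Lemma 4.5 (4.38) p.674 (shape)] -/
def opSiteKernel (Xf Xc : Tor N → ℝ) (L M : ℝ) (k : ℕ) : B9.SiteKernel (torusOpGeo d L M k N) pt9Bg :=
  ⟨fun _ y y' => Xf (y - y') - Xc (y - y')⟩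

/-- Unfolding of `opSiteKernel`. [cite: King1986, Lemma 4.5 (4.38) p.674 (shape)] [folklore] -/
@[simp] theorem opSiteKernel_ker (Xf Xc : Tor N → ℝ) (L M : ℝ) (k : ℕ) (U : pt9Bg.Cfg)
    (y y' : (torusOpGeo d L M k N).Site) :
    (opSiteKernel Xf Xc L M k).ker U y y' = Xf (y - y') - Xc (y - y') := rfl

/-- **THE SITE LAYER DOES NOT SEE THE ARGUMENT SORT**: the typed site inequality for `opSiteKernel` on the operator carrier IS the
one for `torusStepKernel` on the site carrier — same sites, lengths, metric, rate factors (definitionally). [cite: Balaban1985BackgroundPropagators, Thm 3.2 (3.48) p.398 (shape)] [folklore] -/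
theorem etaRateIneqSite_op_iff_site (L M : ℝ) (k : ℕ) (Xf Xc : Tor N → ℝ) (d' : ℕ) (p C δ γ : ℝ) (U : pt9Bg.Cfg) :
    EtaRateIneqSite d' p (opSiteKernel Xf Xc L M k) C δ γ U ↔
      EtaRateIneqSite d' p (torusStepKernel (N := N) Xf Xc L M k) C δ γ U :=
  Iff.rfl

/-- The dictionary at one torus point: the site inequality IS `∀ t, |Xf(t) − Xc(t)| ≤ C·e^{−δ|t|_{T,∞}}·(L^{−γ})^k` (`L > 0`). [cite: King1986, Lemma 4.5 (4.38) p.674 (A = 0 sibling, shape)] [folklore] -/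
theorem etaRateIneqSite_op_iff' {L : ℝ} (hL : 0 < L) (M : ℝ) (k : ℕ) (Xf Xc : Tor N → ℝ) (d' : ℕ) (p C δ γ : ℝ)
    (U : pt9Bg.Cfg) :
    EtaRateIneqSite d' p (opSiteKernel Xf Xc L M k) C δ γ U ↔
      ∀ t : Tor N, |Xf t - Xc t| ≤ C * Real.exp (-(δ * torusSupNorm N (rep N t))) * (L ^ (-γ)) ^ k := by
  rw [etaRateIneqSite_op_iff_site, etaRateIneqSite_torus_iff' hL]

end OpSite

/-- The η-difference SITE kernels of a torus family `X` over the OPERATOR family `torusOpInstance`: at index `(k, N, M)` the kernel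
of `X_N (k+1) − X_N k`. [cite: King1986, p.664 (identity pairing) and Lemma 4.5 (4.38) p.674 (shape)] -/
def opSiteKernels (X : TorusFamily d) {L : ℝ} (hL : L ≠ 0) :
    ∀ i : TorusIndex d, B9.SiteKernel (torusOpInstance d hL i).gc (torusOpInstance d hL i).Bf :=
  fun i =>
    haveI := i.neZero
    opSiteKernel (X i.N (i.k + 1)) (X i.N i.k) L i.M i.k

/-- **`NE2PlusSite` MOVES FROM THE SITE FAMILY TO THE OPERATOR FAMILY WITH THE SAME CONSTANTS** (every exponent pair, `c35`): the
guards are the same on both families; the inequality is §1's definitional transfer. [cite: Balaban1985BackgroundPropagators, Thm 3.2 (3.48) p.398 + Thm 3.14 pp.426–427 (quantifier template)] [folklore] -/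
theorem ne2PlusSite_op_of_site {X : TorusFamily d} {L : ℝ} (hL : L ≠ 0) {d' : ℕ} {p c35 : ℝ}
    (h : NE2PlusSite d' p c35 (torusInstance d hL) (torusStepKernels X hL)) :
    NE2PlusSite d' p c35 (torusOpInstance d hL) (opSiteKernels X hL) := by
  obtain ⟨M₅, δ, a₀, C, γ, hM, hδ, ha, hC, hγ, H⟩ := h
  refine ⟨M₅, δ, a₀, C, γ, hM, hδ, ha, hC, hγ, fun i hMi α₀ hα hMa U hU => ?_⟩
  haveI := i.neZero
  exact (etaRateIneqSite_op_iff_site (N := i.N) L i.M i.k (X i.N (i.k + 1)) (X i.N i.k) d' p C δ γ U).mpr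
    (H i hMi α₀ hα hMa U hU)

/-- **`NE2ZeroSite` MOVES FROM THE SITE FAMILY TO THE OPERATOR FAMILY**, same constants (every exponent pair). [cite: King1986, Props. 3.8–3.9 (3.71)–(3.75) pp.664–665 (A = 0 model, shape)] [folklore] -/
theorem ne2ZeroSite_op_of_site {X : TorusFamily d} {L : ℝ} (hL : L ≠ 0) {d' : ℕ} {p : ℝ}
    (h : NE2ZeroSite d' p (torusInstance d hL) (torusStepKernels X hL)) :
    NE2ZeroSite d' p (torusOpInstance d hL) (opSiteKernels X hL) := by
  obtain ⟨M₅, δ, C, γ, hM, hδ, hC, hγ, H⟩ := h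
  refine ⟨M₅, δ, C, γ, hM, hδ, hC, hγ, fun i hMi => ?_⟩
  haveI := i.neZero
  exact (etaRateIneqSite_op_iff_site (N := i.N) L i.M i.k (X i.N (i.k + 1)) (X i.N i.k) d' p C δ γ _).mpr (H i hMi)

/-! ## §2 Re-indexing: sub-families inherit the packaged layers with the same uniform constants -/

section Reindex

variable {I J : Type} (f : J → I) {pi : I → PairedInstance}

/-- `NE2PlusOperator` restricts along any map of index types (same constants). [cite: Balaban1985BackgroundPropagators, Thm 3.1 p.397 (quantifier template)] [folklore] -/
theorem ne2PlusOperator_reindex {c35 : ℝ} {Kd : ∀ i, B9.KernelFamily (pi i).gc (pi i).Bf}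
    (h : NE2PlusOperator c35 pi Kd) : NE2PlusOperator c35 (fun j => pi (f j)) (fun j => Kd (f j)) := by
  obtain ⟨M₅, δ₀, a₀, B₀, γ, hM, hδ, ha, hB, hγ, H⟩ := h
  exact ⟨M₅, δ₀, a₀, B₀, γ, hM, hδ, ha, hB, hγ, fun j => H (f j)⟩

/-- `NE2ZeroOperator` restricts along any map of index types (same constants). [cite: King1986, Props. 3.8–3.9 (3.71)–(3.75) pp.664–665 (A = 0 model, shape)] [folklore] -/
theorem ne2ZeroOperator_reindex {Kd : ∀ i, B9.KernelFamily (pi i).gc (pi i).Bf}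
    (h : NE2ZeroOperator pi Kd) : NE2ZeroOperator (fun j => pi (f j)) (fun j => Kd (f j)) := by
  obtain ⟨M₅, δ₀, B₀, γ, hM, hδ, hB, hγ, H⟩ := h
  exact ⟨M₅, δ₀, B₀, γ, hM, hδ, hB, hγ, fun j => H (f j)⟩

/-- `NE2PlusSite` restricts along any map of index types (same constants). [cite: Balaban1985BackgroundPropagators, Thm 3.2 (3.48) p.398 (quantifier template)] [folklore] -/
theorem ne2PlusSite_reindex {d' : ℕ} {p c35 : ℝ} {Kd : ∀ i, B9.SiteKernel (pi i).gc (pi i).Bf}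
    (h : NE2PlusSite d' p c35 pi Kd) : NE2PlusSite d' p c35 (fun j => pi (f j)) (fun j => Kd (f j)) := by
  obtain ⟨M₅, δ, a₀, C, γ, hM, hδ, ha, hC, hγ, H⟩ := h
  exact ⟨M₅, δ, a₀, C, γ, hM, hδ, ha, hC, hγ, fun j => H (f j)⟩

/-- `NE2ZeroSite` restricts along any map of index types (same constants). [cite: Balaban1985BackgroundPropagators, Thm 3.2 (3.48) p.398 (quantifier template)] [folklore] -/
theorem ne2ZeroSite_reindex {d' : ℕ} {p : ℝ} {Kd : ∀ i, B9.SiteKernel (pi i).gc (pi i).Bf}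
    (h : NE2ZeroSite d' p pi Kd) : NE2ZeroSite d' p (fun j => pi (f j)) (fun j => Kd (f j)) := by
  obtain ⟨M₅, δ, C, γ, hM, hδ, hC, hγ, H⟩ := h
  exact ⟨M₅, δ, C, γ, hM, hδ, hC, hγ, fun j => H (f j)⟩

/-- `NE2PlusUnit` restricts along any map of index types (same constants). [cite: Balaban1985BackgroundPropagators, Thm 3.15 (3.187) p.432 (quantifier template)] [folklore] -/
theorem ne2PlusUnit_reindex {c35 : ℝ} {Kd : ∀ i, B9.SiteKernel (pi i).gc (pi i).Bf}
    {inΛ : ∀ i, (pi i).gc.Site → Prop} {unitDist : ∀ i, (pi i).gc.Site → (pi i).gc.Site → ℝ}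
    (h : NE2PlusUnit c35 pi Kd inΛ unitDist) :
    NE2PlusUnit c35 (fun j => pi (f j)) (fun j => Kd (f j)) (fun j => inΛ (f j)) (fun j => unitDist (f j)) := by
  obtain ⟨δ₀, a₀, B₀, θ, hδ, ha, hB, hθ0, hθ1, H⟩ := h
  exact ⟨δ₀, a₀, B₀, θ, hδ, ha, hB, hθ0, hθ1, fun j => H (f j)⟩

end Reindex

/-! ## §3 The knit family of record for the `U ≡ 1` torus model, and the covariance unit layer on it -/

/-- THE INDEX OF THE KNIT FAMILY: the lineage's torus index `(k, N, M)` (coarse run with `k` scales, unit torus `Tor N`, cube size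
`M ≥ 1`) restricted to period vectors divisible by the block factor `L` — the block structure on which the one-step fluctuation
covariance (2.156) lives. [cite: Balaban1984PropagatorsII, (2.156) p.250 (object: the torus of L-blocks)] -/
abbrev KnitIndex (d L : ℕ) : Type := {i : TorusIndex d // ∀ μ, L ∣ i.N μ}

/-- NON-VACUITY of the index: the unit torus with all periods equal to `L` (so `L ∣ N_μ`), any number of scales `k`, cube size
`M = 1`. [cite: Balaban1984PropagatorsII, (2.156) p.250 (object: the torus of L-blocks)] -/
def KnitIndex.cube (d L : ℕ) [NeZero L] (k : ℕ) : KnitIndex d L :=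
  ⟨{ k := k, N := fun _ => L, M := 1, one_le := le_rfl }, fun _ => dvd_rfl⟩

/-- The index type is inhabited. [folklore] -/
instance knitIndex_nonempty (d L : ℕ) [NeZero L] : Nonempty (KnitIndex d L) := ⟨KnitIndex.cube d L 0⟩
/-- THE KNIT FAMILY OF PAIRED INSTANCES (family of record for the `U ≡ 1` torus model of node N15): the OPERATOR carriers
`T4EtaRateOperatorTorus.torusOpInstance` (sites `Tor N`, test functions `Tor N → ℝ`, runs `k`/`k + 1` at `η = L^{−k}`, identity
pairing, one-point backgrounds) over the L-divisible index. [cite: Balaban1985BackgroundPropagators, (3.41)–(3.42) p.397 (carrier conventions); King1986, p.664 (identity pairing)] -/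
def knitInstance (d L : ℕ) [NeZero L] : KnitIndex d L → PairedInstance :=
  fun i => torusOpInstance d (L := (L : ℝ)) (Nat.cast_ne_zero.mpr (NeZero.ne L)) i.1

section Unit

variable (L : ℕ) [NeZero L]

/-- THE UNIT-LAYER KERNEL ON THE OPERATOR CARRIER: the η-difference `C^{(L^{k+1})}(b, b′) − C^{(L^k)}(b, b′)` of the one-step
fluctuation covariance (2.156) at `U ≡ 1` (`T4EtaRateUnitWitness.covDiff`, one extra scale) at the bonds `b = (y, α)`, `b′ = (y′, β)`
with base points `y, y′ ∈ Tor N` (box representatives) and FIXED directions. [cite: Balaban1984PropagatorsII, (2.156) p.250 (object); Balaban1985BackgroundPropagators, Thm 3.15 (3.187) p.432 (C^{(k)}(Λ), shape)] -/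
def covOpKernel (α β : Fin (d + 1)) (N : Fin (d + 1) → ℕ) [∀ μ, NeZero (N μ)] (M : ℝ) (k : ℕ) :
    B9.SiteKernel (torusOpGeo d (L : ℝ) M k N) pt9Bg :=
  ⟨fun _ y y' => covDiff L N k 1 (⟨rep N y, rep_mem_pbox N y⟩, α) (⟨rep N y', rep_mem_pbox N y'⟩, β)⟩

/-- The unit-layer kernels over the knit family. [cite: Balaban1984PropagatorsII, (2.156) p.250 (object)] -/
def covOpKernels (α β : Fin (d + 1)) :
    ∀ i : KnitIndex d L, B9.SiteKernel (knitInstance d L i).gc (knitInstance d L i).Bf :=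
  fun i =>
    haveI := i.1.neZero
    covOpKernel L α β i.1.N i.1.M i.1.k

/-- `inΛ := True`: at `U ≡ 1` there are no large-field holes — every site of the unit torus belongs to `Λ`. [cite: Balaban1985BackgroundPropagators, Thm 3.15 (3.187) p.432 (the region Λ, shape)] -/
def inAll : ∀ i : KnitIndex d L, (knitInstance d L i).gc.Site → Prop := fun _ _ => True

/-- `unitDist :=` the periodic unit-lattice distance `ρ_N` of the base points (the metric of the tree's (2.156) decay / rate
theorems). [cite: Balaban1985BackgroundPropagators, Thm 3.15 (3.187) p.432 (the unit-lattice distance |y − y′|, shape)] -/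
def rhoDist : ∀ i : KnitIndex d L, (knitInstance d L i).gc.Site → (knitInstance d L i).gc.Site → ℝ :=
  fun i y y' =>
    haveI := i.1.neZero
    pdist i.1.N (one_le_M i.1.N) (rep i.1.N y) (rep i.1.N y')

/-- **`EtaRateIneqUnit` HOLDS FOR `C^{(k)}(𝟙)` ON THE KNIT FAMILY, hypothesis-free** (torus dimension `d + 1 ≥ 2`, `L ≥ 1`): ONE
`(B₀, δ₀)` in `(d, L)` such that for EVERY index with `L ∣ N`, every direction pair and the (unique) background,
`|C^{(L^{k+1})}((y,α),(y′,β)) − C^{(L^k)}((y,α),(y′,β))| ≤ B₀·e^{−δ₀ρ_N(y,y′)}·(L⁻¹)^k` — `T4Cov2156Rate.cov2156_rate_torus_king` at one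
extra scale, read at base points. [cite: King1986, Lemma 4.5 (4.38) p.674 (A = 0 shape); Balaban1984PropagatorsII, (2.156) p.250 (object)] [folklore] -/
theorem etaRateIneqUnit_cov_knit (hd : 1 ≤ d) :
    ∃ B₀ δ₀ : ℝ, 0 < B₀ ∧ 0 < δ₀ ∧ ∀ (α β : Fin (d + 1)) (i : KnitIndex d L) (U : (knitInstance d L i).Bf.Cfg),
      EtaRateIneqUnit (covOpKernels L α β i) (inAll L i) (rhoDist L i) B₀ δ₀ ((L : ℝ)⁻¹) i.1.k U := by
  have hL1 : 1 ≤ L := Nat.one_le_iff_ne_zero.mpr (NeZero.ne L)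
  obtain ⟨C', δ', hC', hδ', H⟩ := cov2156_rate_torus_king (d + 1) (by omega) hL1
  refine ⟨C', δ', hC', hδ', fun α β i U y y' _ _ => ?_⟩
  haveI := i.1.neZero
  have h := H i.1.N i.2 i.1.k 1 (⟨rep i.1.N y, rep_mem_pbox i.1.N y⟩, α) (⟨rep i.1.N y', rep_mem_pbox i.1.N y'⟩, β)
  show |covDiff L i.1.N i.1.k 1 (⟨rep i.1.N y, rep_mem_pbox i.1.N y⟩, α) (⟨rep i.1.N y', rep_mem_pbox i.1.N y'⟩, β)| ≤
    C' * Real.exp (-(δ' * pdist i.1.N (one_le_M i.1.N) (rep i.1.N y) (rep i.1.N y'))) * ((L : ℝ)⁻¹) ^ i.1.k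
  calc |covDiff L i.1.N i.1.k 1 (⟨rep i.1.N y, rep_mem_pbox i.1.N y⟩, α) (⟨rep i.1.N y', rep_mem_pbox i.1.N y'⟩, β)|
      ≤ C' * ((L : ℝ) ^ i.1.k)⁻¹ *
          Real.exp (-(δ' * pdist i.1.N (one_le_M i.1.N) (rep i.1.N y) (rep i.1.N y'))) := h
    _ = C' * Real.exp (-(δ' * pdist i.1.N (one_le_M i.1.N) (rep i.1.N y) (rep i.1.N y'))) * ((L : ℝ)⁻¹) ^ i.1.k := by
      rw [inv_pow]; ring

/-- **`NE2PlusUnit` IS INHABITED BY `C^{(k)}(𝟙)` ON THE KNIT FAMILY** (`d ≥ 1`, `L ≥ 2`, every direction pair and `c35`):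
`(δ₀, a₀, B₀, θ) = (δ₀, 1, B₀, L⁻¹)`.  HONEST SCOPE (i): backgrounds range over `{U ≡ 1}` — NE2⁰-unit CONTENT inside NE2⁺-unit's
TYPE; rate, decay, uniformity genuine. [cite: Balaban1985BackgroundPropagators, Thm 3.15 (3.187) p.432 (quantifier template); King1986, Lemma 4.5 (4.38) p.674 (shape)] [folklore] -/
theorem ne2PlusUnit_cov_knit (hd : 1 ≤ d) (hL : 2 ≤ L) (α β : Fin (d + 1)) (c35 : ℝ) :
    NE2PlusUnit c35 (knitInstance d L) (covOpKernels L α β) (inAll L) (rhoDist L) := by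
  obtain ⟨B₀, δ₀, hB₀, hδ₀, H⟩ := etaRateIneqUnit_cov_knit (d := d) L hd
  have hLpos : (0 : ℝ) < L := by exact_mod_cast (lt_of_lt_of_le zero_lt_two hL)
  have hθ1 : ((L : ℝ)⁻¹) < 1 := inv_lt_one_of_one_lt₀ (by exact_mod_cast hL)
  exact ⟨δ₀, 1, B₀, (L : ℝ)⁻¹, hδ₀, one_pos, hB₀, inv_pos.mpr hLpos, hθ1, fun i _ _ _ U _ _ => H α β i U⟩

/-- **NE2⁰-unit IS A THEOREM for `C^{(k)}(𝟙)` on the knit family** (`d ≥ 1`, `L ≥ 2`): `T4EtaRateUnitWitness.NE2ZeroUnit` through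
`ne2ZeroUnit_of_ne2PlusUnit` (cube sizes `M ≥ 1 > 0`, trivial regularity). [cite: King1986, Lemma 4.5 (4.38) p.674 (A = 0 shape)] [folklore] -/
theorem ne2ZeroUnit_cov_knit (hd : 1 ≤ d) (hL : 2 ≤ L) (α β : Fin (d + 1)) :
    NE2ZeroUnit (knitInstance d L) (covOpKernels L α β) (inAll L) (rhoDist L) :=
  ne2ZeroUnit_of_ne2PlusUnit (c35 := 0) (fun i => lt_of_lt_of_le one_pos i.1.one_le) (fun _ _ _ => trivial)
    (fun _ _ _ => trivial) (ne2PlusUnit_cov_knit L hd hL α β 0)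

end Unit

/-! ## §4 The (1.63) site layer, HYPOTHESIS-FREE: the strip rate of the zero-offset `H_k` multipliers is a theorem of the tree -/

section Layer163

variable (L : ℕ) [NeZero L]

/-- **THE SCALE-UNIFORM STRIP RATE OF THE (1.63) ZERO-OFFSET MULTIPLIERS** (every `L ≥ 1`, `μ`, `λ`, `k`):
`StripRegular (G₀^{(L^{k+1})} − G₀^{(L^k)}) κ₁₆₃(d+1) (CGe(d+1)/L^k)` — `T4Hk163StripRate.stripRegular_G163_sub` at the physically paired
zero offsets (`zeroOffset_phys`), `1 ≤ L^k ≤ L^{k+1}`; exactly the hypothesis `hsub` of `ne2PlusSite_hk163Zero_of_stripRate`,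
`A = CGe (d+1)`. [cite: Balaban1984PropagatorsI, (1.63) p.28 (object); King1986, Prop. 3.8 (3.71) p.664 (A = 0 sibling, shape)] [folklore] -/
theorem stripRate_hk163Zero (μ lam : Fin (d + 1)) (k : ℕ) :
    StripRegular (d := d)
      (fun p => G163 (L ^ (k + 1)) μ lam (zeroOffset (L ^ (k + 1))) p - G163 (L ^ k) μ lam (zeroOffset (L ^ k)) p)
      (kappa163 (d + 1)) (CGe (d + 1) / (L : ℝ) ^ k) := by
  have hL : 0 < L := Nat.pos_of_ne_zero (NeZero.ne L)
  have h := stripRegular_G163_sub (d := d) (n := L ^ k) (m := L ^ (k + 1)) (Nat.one_le_pow _ _ hL)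
    (Nat.pow_le_pow_right hL (Nat.le_succ k)) (kappa163_pos _).le le_rfl μ lam
    (zeroOffset (L ^ k)) (zeroOffset (L ^ (k + 1))) (zeroOffset_phys L k 1)
  have hcast : CGe (d + 1) / ((L ^ k : ℕ) : ℝ) = CGe (d + 1) / (L : ℝ) ^ k := by rw [Nat.cast_pow]
  exact hcast ▸ h

/-- **`NE2PlusSite` IS INHABITED BY THE (1.63) ZERO-OFFSET `H_k` TORUS FAMILY, HYPOTHESIS-FREE, UNIFORMLY IN THE VOLUME** (site
carrier family; every `L ≥ 1`, `μ`, `λ`, exponent pair, `c35`; `γ = 1`, `δ = delta163T d`) — the companion discharge announced in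
`T4EtaRateSiteTorus163` §4.  HONEST SCOPE (i). [cite: Balaban1984PropagatorsI, (1.63) p.28 (object); Balaban1985BackgroundPropagators, Thm 3.14 pp.426–427 (quantifier template)] [folklore] -/
theorem ne2PlusSite_hk163Zero (μ lam : Fin (d + 1)) (d' : ℕ) (p c35 : ℝ) :
    NE2PlusSite d' p c35 (torusInstance d (L := (L : ℝ)) (Nat.cast_ne_zero.mpr (NeZero.ne L)))
      (torusStepKernels (hk163ZeroFamily (d := d) L μ lam) (Nat.cast_ne_zero.mpr (NeZero.ne L))) :=
  ne2PlusSite_hk163Zero_of_stripRate L μ lam (A := CGe (d + 1)) (fun k => stripRate_hk163Zero L μ lam k) d' p c35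

/-- **`NE2ZeroSite` IS A THEOREM for the (1.63) zero-offset `H_k` torus family, HYPOTHESIS-FREE** (every `L ≥ 1`, `μ`, `λ`, exponent
pair; `γ = 1`). [cite: Balaban1984PropagatorsI, (1.63) p.28 (object); King1986, Prop. 3.8 (3.71) p.664 (A = 0 model, shape)] [folklore] -/
theorem ne2ZeroSite_hk163Zero (μ lam : Fin (d + 1)) (d' : ℕ) (p : ℝ) :
    NE2ZeroSite d' p (torusInstance d (L := (L : ℝ)) (Nat.cast_ne_zero.mpr (NeZero.ne L)))
      (torusStepKernels (hk163ZeroFamily (d := d) L μ lam) (Nat.cast_ne_zero.mpr (NeZero.ne L))) :=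
  ne2ZeroSite_hk163Zero_of_stripRate L μ lam (A := CGe (d + 1)) (fun k => stripRate_hk163Zero L μ lam k) d' p

end Layer163

/-! ## §5 THE KNIT: the N15 conjunction `NE2PlusOperator ∧ NE2PlusSite 4 p ∧ NE2PlusUnit` on ONE family -/

section Knit

variable (L : ℕ) [NeZero L]

/-- THE OPERATOR-LAYER KERNELS on the knit family for a torus family `X`: the four (3.42) entries of the η-difference convolution
operator of `X_N (k+1) − X_N k` (`T4EtaRateOperatorTorus.torusOpKernelFamilies`, restricted). [cite: Balaban1985BackgroundPropagators, (3.42) p.397 (shape)] -/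
def knitOp (X : TorusFamily d) : ∀ i : KnitIndex d L, B9.KernelFamily (knitInstance d L i).gc (knitInstance d L i).Bf :=
  fun i => torusOpKernelFamilies X (Nat.cast_ne_zero.mpr (NeZero.ne L)) i.1

/-- THE SITE-LAYER KERNELS OF RECORD on the knit family for a torus family `Y` (§1's `opSiteKernels`, restricted). [cite: Balaban1985BackgroundPropagators, Thm 3.2 (3.48) p.398 (shape)] -/
def knitSite (Y : TorusFamily d) : ∀ i : KnitIndex d L, B9.SiteKernel (knitInstance d L i).gc (knitInstance d L i).Bf :=
  fun i => opSiteKernels Y (Nat.cast_ne_zero.mpr (NeZero.ne L)) i.1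

/-- **THE KNIT FROM STEP BOUNDS** (`d ≥ 1`, `L ≥ 2`): two `(k, N)`-uniform King-shape torus step bounds — for the operator object `X`
(amplitude `A_X·(L^k)^{−γ_X}`, decay `δ_X`) and the site object `Y` (`A_Y·(L^k)^{−γ_Y}`, `δ_Y`), all `δ, γ > 0` — GIVE THE N15
CONJUNCTION on `knitInstance d L` with the operator family of `X`, the site kernels of `Y` and the covariance unit layer (§3,
hypothesis-free), every `c35`, `p`, direction pair: the slot for any further torus rate theorem or a background-layer estimate
reduced to this format.  HONEST SCOPE (i)–(iii). [cite: Balaban1985BackgroundPropagators, Thm 3.1 p.397, Thm 3.2 (3.48) p.398, Thm 3.15 (3.187) p.432 + Thm 3.14 pp.426–427 (quantifier templates); King1986, Lemma 4.5 (4.38) p.674 (A = 0 template)] [folklore] -/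
theorem n15_knit_of_bounds (hd : 1 ≤ d) (hL : 2 ≤ L) {X Y : TorusFamily d} {AX δX γX AY δY γY : ℝ}
    (hδX : 0 < δX) (hγX : 0 < γX)
    (hX : ∀ (N : Fin (d + 1) → ℕ) [∀ μ, NeZero (N μ)] (k : ℕ) (x : Fin (d + 1) → ℤ),
      |X N (k + 1) (toT N x) - X N k (toT N x)| ≤ AX * ((L : ℝ) ^ k) ^ (-γX) * Real.exp (-(δX * torusSupNorm N x)))
    (hδY : 0 < δY) (hγY : 0 < γY)
    (hY : ∀ (N : Fin (d + 1) → ℕ) [∀ μ, NeZero (N μ)] (k : ℕ) (x : Fin (d + 1) → ℤ),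
      |Y N (k + 1) (toT N x) - Y N k (toT N x)| ≤ AY * ((L : ℝ) ^ k) ^ (-γY) * Real.exp (-(δY * torusSupNorm N x)))
    (α β : Fin (d + 1)) (c35 p : ℝ) :
    NE2PlusOperator c35 (knitInstance d L) (knitOp L X) ∧
      NE2PlusSite 4 p c35 (knitInstance d L) (knitSite L Y) ∧
      NE2PlusUnit c35 (knitInstance d L) (covOpKernels L α β) (inAll L) (rhoDist L) := by
  have hLpos : (0 : ℝ) < L := by exact_mod_cast (lt_of_lt_of_le zero_lt_two hL)
  refine ⟨?_, ?_, ne2PlusUnit_cov_knit L hd hL α β c35⟩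
  · exact ne2PlusOperator_reindex Subtype.val (ne2PlusOperator_torus_of_bound_rpow hLpos hδX hγX hX c35)
  · exact ne2PlusSite_reindex Subtype.val
      (ne2PlusSite_op_of_site _ (ne2PlusSite_torus_of_bound_rpow hLpos hδY hγY hY 4 p c35))

/-- THE OPERATOR-LAYER KERNELS OF RECORD OF THE LG-VECTOR KNIT: the (1.66) `Δ_k` torus entry kernels `Re K^{(L^k)}_{ab,N}` of the
`(μ, ν)` term (`ksum166Family`) through the four (3.42) entries of the η-difference convolution operator. [cite: Balaban1984PropagatorsI, (1.66) p.29 (object); Balaban1985BackgroundPropagators, (3.42) p.397 (shape)] -/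
def knitOp166 (μ ν a b : Fin (d + 1)) :
    ∀ i : KnitIndex d L, B9.KernelFamily (knitInstance d L i).gc (knitInstance d L i).Bf :=
  knitOp L (ksum166Family (d := d) L μ ν a b)

/-- THE SITE-LAYER KERNELS OF RECORD OF THE LG-VECTOR KNIT: the (1.63) `H_k` zero-offset torus kernels (`hk163ZeroFamily`) as
η-difference site kernels on the operator carrier. [cite: Balaban1984PropagatorsI, (1.63) p.28 (object); Balaban1985BackgroundPropagators, Thm 3.2 (3.48) p.398 (shape)] -/
def knitSite163 (μ lam : Fin (d + 1)) :
    ∀ i : KnitIndex d L, B9.SiteKernel (knitInstance d L i).gc (knitInstance d L i).Bf :=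
  knitSite L (hk163ZeroFamily (d := d) L μ lam)

/-- **THE N15 KNIT FOR THE LANDAU-GAUGE VECTOR LINEAR THEORY AT `U ≡ 1`, BY NAME, HYPOTHESIS-FREE** (`d ≥ 1`, `L ≥ 2`, `μ ≠ ν`, all
labels, every `c35`, `p`): on the ONE family `knitInstance d L`, `NE2PlusOperator c35 _ (Δ_k (1.66) entries, King's γ = 2) ∧
NE2PlusSite 4 p c35 _ (H_k (1.63) zero offset, γ = 1) ∧ NE2PlusUnit c35 _ (C^{(k)} (2.156), θ = L⁻¹) inAll rhoDist` — the venue's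
`YMDAG.N15 c35 p (knitInstance d L) (knitOp166 …) (knitSite163 …) (covOpKernels …) (inAll L) (rhoDist L)` unfolded one step.  Inputs BY
NAME: `ne2PlusOperator_ksum166_king` (⇐ `T4Rate166StripDirect.ksum_rate2_king`), §4 (⇐ `stripRegular_G163_sub`), §3
(⇐ `cov2156_rate_torus_king`).  HONEST SCOPE (i)–(iv): NE2⁰ CONTENT inside the NE2⁺ TYPE; NOT the background layer; NOT a node
discharge (the carriers of record of Bałaban's run are NODE 00's). [cite: Balaban1984PropagatorsI, (1.63) p.28 and (1.66) p.29 (objects); Balaban1984PropagatorsII, (2.156) p.250 (object); Balaban1985BackgroundPropagators, Thm 3.1 p.397 + Thm 3.2 (3.48) p.398 + Thm 3.15 (3.187) p.432 (quantifier templates); King1986, Prop. 3.9 (3.73) p.665 and Lemma 4.5 (4.38) p.674 (rate factor; A = 0 template)] [folklore] -/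
theorem n15_knit_LG (hd : 1 ≤ d) (hL : 2 ≤ L) {μ ν : Fin (d + 1)} (hμν : μ ≠ ν) (a b μ' lam α β : Fin (d + 1))
    (c35 p : ℝ) :
    NE2PlusOperator c35 (knitInstance d L) (knitOp166 L μ ν a b) ∧
      NE2PlusSite 4 p c35 (knitInstance d L) (knitSite163 L μ' lam) ∧
      NE2PlusUnit c35 (knitInstance d L) (covOpKernels L α β) (inAll L) (rhoDist L) := by
  refine ⟨?_, ?_, ne2PlusUnit_cov_knit L hd hL α β c35⟩
  · exact ne2PlusOperator_reindex Subtype.val (ne2PlusOperator_ksum166_king (d := d) L hμν a b c35)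
  · exact ne2PlusSite_reindex Subtype.val (ne2PlusSite_op_of_site _ (ne2PlusSite_hk163Zero (d := d) L μ' lam 4 p c35))

/-- **THE `d + 1 = 4` INSTANCE** (the four-dimensional unit torus of the T⁴ programme; `L ≥ 2`, `μ ≠ ν`). [cite: Balaban1985BackgroundPropagators, Thm 3.1 p.397 + Thm 3.2 (3.48) p.398 + Thm 3.15 (3.187) p.432 (quantifier templates); King1986, Lemma 4.5 (4.38) p.674 (A = 0 template)] [folklore] -/
theorem n15_knit_LG_dim4 (hL : 2 ≤ L) {μ ν : Fin 4} (hμν : μ ≠ ν) (a b μ' lam α β : Fin 4) (c35 p : ℝ) :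
    NE2PlusOperator c35 (knitInstance 3 L) (knitOp166 L μ ν a b) ∧
      NE2PlusSite 4 p c35 (knitInstance 3 L) (knitSite163 L μ' lam) ∧
      NE2PlusUnit c35 (knitInstance 3 L) (covOpKernels L α β) (inAll L) (rhoDist L) :=
  n15_knit_LG (d := 3) L (by norm_num) hL hμν a b μ' lam α β c35 p

/-- **THE TRIVIAL-BACKGROUND OPERATOR LAYER (the venue's `N15zero`) IS A THEOREM for the (1.66) kernels of record** (every `L ≥ 1`,
`μ ≠ ν`; `γ = 2`), hypothesis-free, uniformly in `(k, N, M)`. [cite: King1986, Props. 3.8–3.9 (3.71)–(3.75) pp.664–665 (A = 0 model, shape); Balaban1984PropagatorsI, (1.66) p.29 (object)] [folklore] -/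
theorem n15zero_knit_LG {μ ν : Fin (d + 1)} (hμν : μ ≠ ν) (a b : Fin (d + 1)) :
    NE2ZeroOperator (knitInstance d L) (knitOp166 L μ ν a b) :=
  ne2ZeroOperator_reindex Subtype.val (ne2ZeroOperator_ksum166_king (d := d) L hμν a b)

/-- … and the trivial-background SITE layer for the (1.63) kernels of record (every `L ≥ 1`, `μ`, `λ`, exponent pair). [cite: Balaban1984PropagatorsI, (1.63) p.28 (object); King1986, Prop. 3.8 (3.71) p.664 (A = 0 model, shape)] [folklore] -/
theorem ne2ZeroSite_knit_LG (μ lam : Fin (d + 1)) (d' : ℕ) (p : ℝ) :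
    NE2ZeroSite d' p (knitInstance d L) (knitSite163 L μ lam) :=
  ne2ZeroSite_reindex Subtype.val (ne2ZeroSite_op_of_site _ (ne2ZeroSite_hk163Zero (d := d) L μ lam d' p))

end Knit

end

end Literature.MathematicalPhysics.QuantumFieldTheory.Balaban1983to89.NE2NodeTorus
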